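import Mathlib
import Summits.ValiantsHypothesis.ValiantsHypothesis.Theorems.NewtonUnitEquationsTwoProductsDepthOne

/-!
# Radix residue off the lattice: south-west vertices outside `M • ℕ²` are monomials of `F`

For a multiscale product `P = F * expand M C` (where `MvPolynomial.expand M` substitutes
`x ↦ x^M`, `y ↦ y^M`) with `M ≥ 1` and `C(0) ≠ 0`, and a strictly positive weight `w`, a nonzero
support point `e` of `P` that is the strict `w`-minimiser among the nonzero support points of `P`
and does not lie on the lattice `M • ℕ²` is a support point of the fine factor `F`.

Proof.  Every support point of `P` is `a + M • b` with `a ∈ supp F`, `b ∈ supp C`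
(`MvPolynomial.coeff_mul`, `MvPolynomial.support_expand`), so `a ≡ e (mod M)` coordinatewise.
Among the monomials of `F` in the residue class of `e` pick a `w`-lightest one, `d₀`.  In the
Cauchy product for `coeff d₀ P` only the term `(d₀, 0)` survives: any other nonzero term
`(a, M • b)` with `b ≠ 0` would put the strictly lighter monomial `a` of `F` in the same class.
Hence `coeff d₀ P = F_{d₀} · C_0 ≠ 0`, and `d₀ ≠ 0` because `e` is off the lattice.  Strict
minimality of `e` then forces `e = d₀`: otherwise `wt e < wt d₀ ≤ wt a ≤ wt e` for the
decomposition `e = a + M • b`.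

The positivity facts for weights (`wt_nonneg`, `wt_pos`) are reused from the landed module
`NewtonUnitEquationsTwoProductsDepthOne`.
-/

set_option linter.dupNamespace false

namespace Summit.ValiantsHypothesis.ValiantsHypothesis.Theorems.TwoProducts.RadixResidueOff

open MvPolynomial

/-- A nonzero term of the Cauchy product `F * expand M C` at the pair `x = (a, b')` has
`coeff a F ≠ 0` and `b' = M • b` for some `b` with `coeff b C ≠ 0` (for `M ≠ 0`). -/
theorem term_ne_zero {M : ℕ} (hM : M ≠ 0) (F C : MvPolynomial (Fin 2) ℂ)
    (x : (Fin 2 →₀ ℕ) × (Fin 2 →₀ ℕ))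
    (hx : coeff x.1 F * coeff x.2 (expand M C) ≠ 0) :
    coeff x.1 F ≠ 0 ∧ ∃ b : Fin 2 →₀ ℕ, coeff b C ≠ 0 ∧ x.2 = M • b := by
  classical
  refine ⟨left_ne_zero_of_mul hx, ?_⟩
  have h2 : x.2 ∈ (expand M C).support := mem_support_iff.mpr (right_ne_zero_of_mul hx)
  rw [support_expand C hM, Finset.mem_image] at h2
  obtain ⟨b, hb, hb'⟩ := h2
  exact ⟨b, mem_support_iff.mp hb, hb'.symm⟩

/-- Residues modulo `M` of the coordinates of `a + M • b` are those of `a`. -/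
theorem mod_add_smul_apply (M : ℕ) (a b : Fin 2 →₀ ℕ) (i : Fin 2) :
    (a + M • b) i % M = a i % M := by
  simp [Finsupp.add_apply, Finsupp.smul_apply, smul_eq_mul, Nat.add_mul_mod_self_left]

/-- The `w`-weight of `a + M • b` is the weight of `a` plus `M` times the weight of `b`. -/
theorem wt_add_smul (w : Fin 2 → ℤ) (M : ℕ) (a b : Fin 2 →₀ ℕ) :
    w 0 * ((a + M • b) 0 : ℤ) + w 1 * ((a + M • b) 1 : ℤ) =
      (w 0 * (a 0 : ℤ) + w 1 * (a 1 : ℤ)) + (M : ℤ) * (w 0 * (b 0 : ℤ) + w 1 * (b 1 : ℤ)) := by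
  simp only [Finsupp.add_apply, Finsupp.smul_apply, smul_eq_mul, Nat.cast_add, Nat.cast_mul]
  ring

/-- **Radix residue, off-lattice.**  For `M ≥ 1`, bivariate polynomials `F`, `C` with
`C(0) ≠ 0` and a strictly positive weight `w`: if `e ≠ 0` is a support point of
`F * expand M C` that is strictly `w`-lighter than every other nonzero support point, and
`e ∉ M • ℕ²`, then `e ∈ supp F`. -/
theorem stub_radixResidueOff : ∀ (M : ℕ) (F C : MvPolynomial (Fin 2) ℂ), 1 ≤ M →
    MvPolynomial.coeff 0 C ≠ 0 →
    ∀ (w : Fin 2 → ℤ), 0 < w 0 → 0 < w 1 → ∀ (e : Fin 2 →₀ ℕ), e ≠ 0 →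
    e ∈ (F * MvPolynomial.expand M C).support →
    (∀ e' ∈ (F * MvPolynomial.expand M C).support, e' ≠ 0 → e' ≠ e →
      w 0 * (e 0 : ℤ) + w 1 * (e 1 : ℤ) < w 0 * (e' 0 : ℤ) + w 1 * (e' 1 : ℤ)) →
    ¬ (M ∣ e 0 ∧ M ∣ e 1) → e ∈ F.support := by
  intro M F C hM hC0 w hw0 hw1 e _ heP hmin hndvd
  classical
  have hMne : M ≠ 0 := Nat.one_le_iff_ne_zero.mp hM
  -- Step 1: `e = a + M • b` with `F_a ≠ 0`, `C_b ≠ 0`.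
  have heP' : coeff e (F * expand M C) ≠ 0 := mem_support_iff.mp heP
  rw [coeff_mul] at heP'
  obtain ⟨x, hx, hxne⟩ := Finset.exists_ne_zero_of_sum_ne_zero heP'
  obtain ⟨hxa, b, _, hxb⟩ := term_ne_zero hMne F C x hxne
  rw [Finset.HasAntidiagonal.mem_antidiagonal] at hx
  -- The residue class of `e` inside `supp F`.
  set T : Finset (Fin 2 →₀ ℕ) :=
    F.support.filter (fun d => d 0 % M = e 0 % M ∧ d 1 % M = e 1 % M) with hT
  have hmemT : ∀ d, d ∈ T ↔ coeff d F ≠ 0 ∧ d 0 % M = e 0 % M ∧ d 1 % M = e 1 % M := by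
    intro d
    rw [hT, Finset.mem_filter, mem_support_iff]
  have haT : x.1 ∈ T := by
    rw [hmemT]
    refine ⟨hxa, ?_, ?_⟩
    · rw [← hx, hxb, mod_add_smul_apply]
    · rw [← hx, hxb, mod_add_smul_apply]
  -- Step 2: a `w`-lightest element `d₀` of the class.
  obtain ⟨d₀, hd₀T, hd₀min⟩ :=
    T.exists_min_image (fun d => w 0 * (d 0 : ℤ) + w 1 * (d 1 : ℤ)) ⟨x.1, haT⟩
  obtain ⟨hd₀F, hd₀0, hd₀1⟩ := (hmemT d₀).mp hd₀T
  -- Step 3: `coeff d₀ P = F_{d₀} * C_0`.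
  have hcoeff : coeff d₀ (F * expand M C) = coeff d₀ F * coeff 0 C := by
    rw [coeff_mul, Finset.sum_eq_single (d₀, (0 : Fin 2 →₀ ℕ))]
    · rw [coeff_expand_zero M hMne]
    · intro y hy hyne
      by_contra hyz
      obtain ⟨hya, b', _, hyb⟩ := term_ne_zero hMne F C y hyz
      rw [Finset.HasAntidiagonal.mem_antidiagonal] at hy
      have hb'ne : b' ≠ 0 := by
        rintro rfl
        apply hyne
        have hy2 : y.2 = 0 := by rw [hyb, smul_zero]
        have hy1 : y.1 = d₀ := by rw [← hy, hy2, add_zero]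
        exact Prod.ext hy1 hy2
      have hy1T : y.1 ∈ T := by
        rw [hmemT]
        refine ⟨hya, ?_, ?_⟩
        · rw [← hd₀0, ← hy, hyb, mod_add_smul_apply]
        · rw [← hd₀1, ← hy, hyb, mod_add_smul_apply]
      have h1 : w 0 * (d₀ 0 : ℤ) + w 1 * (d₀ 1 : ℤ) ≤ w 0 * (y.1 0 : ℤ) + w 1 * (y.1 1 : ℤ) :=
        hd₀min y.1 hy1T
      have h2 : w 0 * (d₀ 0 : ℤ) + w 1 * (d₀ 1 : ℤ) = (w 0 * (y.1 0 : ℤ) + w 1 * (y.1 1 : ℤ)) +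
          (M : ℤ) * (w 0 * (b' 0 : ℤ) + w 1 * (b' 1 : ℤ)) := by
        rw [← hy, hyb]
        exact wt_add_smul w M y.1 b'
      have h3 := DepthOne.wt_pos w hw0 hw1 b' hb'ne
      have hM' : (1 : ℤ) ≤ M := by exact_mod_cast hM
      nlinarith
    · intro h
      exact absurd (Finset.HasAntidiagonal.mem_antidiagonal.mpr (add_zero d₀)) h
  -- Step 4: `d₀` is a nonzero support point of `P`.
  have hd₀P : d₀ ∈ (F * expand M C).support := by
    rw [mem_support_iff, hcoeff]
    exact mul_ne_zero hd₀F hC0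
  have hd₀ne : d₀ ≠ 0 := by
    rintro rfl
    apply hndvd
    simp only [Finsupp.coe_zero, Pi.zero_apply, Nat.zero_mod] at hd₀0 hd₀1
    exact ⟨Nat.dvd_of_mod_eq_zero hd₀0.symm, Nat.dvd_of_mod_eq_zero hd₀1.symm⟩
  -- Step 5: strict minimality of `e` forces `e = d₀`.
  by_cases hde : d₀ = e
  · rw [← hde]
    exact mem_support_iff.mpr hd₀F
  · exfalso
    have hlt := hmin d₀ hd₀P hd₀ne hde
    have h1 : w 0 * (d₀ 0 : ℤ) + w 1 * (d₀ 1 : ℤ) ≤ w 0 * (x.1 0 : ℤ) + w 1 * (x.1 1 : ℤ) :=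
      hd₀min x.1 haT
    have h2 : w 0 * (e 0 : ℤ) + w 1 * (e 1 : ℤ) = (w 0 * (x.1 0 : ℤ) + w 1 * (x.1 1 : ℤ)) +
        (M : ℤ) * (w 0 * (b 0 : ℤ) + w 1 * (b 1 : ℤ)) := by
      rw [← hx, hxb]
      exact wt_add_smul w M x.1 b
    have h3 := DepthOne.wt_nonneg w hw0 hw1 b
    have hM' : (0 : ℤ) ≤ M := by positivity
    nlinarith

end Summit.ValiantsHypothesis.ValiantsHypothesis.Theorems.TwoProducts.RadixResidueOff
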